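import Mathlib.Data.Nat.Totient
import Mathlib.FieldTheory.Finite.Basic
import Mathlib.GroupTheory.Perm.Cycle.Type
import Mathlib.NumberTheory.LegendreSymbol.JacobiSymbol
import Mathlib.NumberTheory.LSeries.PrimesInAP
import Literature.Computability.Complexity.Randomized
import HarnessLib

set_option linter.dupNamespace false -- D-0017: single-problem summit ⇒ `QuantumAdvantage.QuantumAdvantage` by design

/-!
# Presentations of the Φ-hiding(3) bit: QR of `−3`, lossy RSA cubing, Jacobi symbol, `3`-adic no-leak

Helper lemmas for crux `stmt-QuantumAdvantage-11826` (`PureCubicClassNumberHard`, route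
`LinnikCubicClassGroups`, line `Sketch`), Tier B of the stub plan for the hypothesis-type leaf
`stub_phiHiding3` (named `PhiHidingThree` in `Theorems/PhiHidingThree.lean`).  They say WHAT the
hidden bit of the leaf is, in three classical vocabularies, and certify that the cheapest classical
statistic carries no information about it:

* `isSquare_neg_three_iff` — for a prime `p ∉ {2, 3}`: `−3` is a square mod `p` iff
  `p ≡ 1 (mod 3)` (the cube roots of unity `(−1 ± √−3)/2`);
* `isSquare_neg_three_zmod_mul_iff`, `type_iff_isSquare_neg_three` — on the promise family of the
  leaf (`N = pq`, `p ≡ q ≡ 1 (mod 3)` or `{p, q} ≡ {2, 5} (mod 9)`) the hidden Eisenstein type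
  `[p ≡ 1 (mod 3)]` is `[−3 ∈ QR_N]`; hence `stub_iff_qrNegThreeHard`: the leaf is worst-case
  hardness of QUADRATIC RESIDUOSITY modulo a composite for the FIXED residue `a = −3` on
  Eisenstein-typed RSA moduli — Adleman–McCurley's open problem (ANTS-I 1994, C11/O11a) at one point;
* `pow_bijective_iff_coprime_card`, `pow_three_bijective_iff` — `x ↦ x³` permutes `(ℤ/N)ˣ` iff
  `3 ∤ φ(N)` (the "lossy vs. injective RSA key `(N, 3)`" reading of Kiltz–O'Neill–Smith 2010 §5);
* `legendreSym_neg_three`, `jacobiSym_neg_three_eq_one` — on odd members of the family the Jacobi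
  symbol `(−3 | N)` is `+1` in BOTH types, so the quadratic character leaks nothing (which is why the
  Schridde–Freisleben break of Φ-hiding for `N = PQ^{2e}` misses `N = pq`);
* `threeAdic_noLeak` — for every `k ≥ 2`, every class `c ≡ 1 (mod 9)` modulo `3^k` contains
  products of both types (Dirichlet), so `N mod 3^k` (the refinement of CMS99's `N mod 3` leak,
  Remark 1) carries no bit either.

All statements are elementary (`Mathlib` only — CRT, Cauchy, Legendre/Jacobi symbols, Dirichlet's
theorem on primes in progressions — plus `RandAlg` for the re-typed leaf).

## References

* L. M. Adleman, K. S. McCurley, *Open problems in number theoretic complexity II*, ANTS-I, LNCS 877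
  (1994), problems C11 / O11a. [AdlemanMcCurley1994]
* C. Cachin, S. Micali, M. Stadler, EUROCRYPT '99, LNCS 1592, §2. [CachinMicaliStadler1999]
* E. Kiltz, A. O'Neill, A. Smith, CRYPTO 2010, LNCS 6223, §5.2.
-/

namespace Summit.QuantumAdvantage.QuantumAdvantage.Theorems

open Literature.Computability.Complexity _root_.Computability

/-! ### `−3` as a quadratic residue modulo a prime -/

/-- **`−3 ∈ QR_p ↔ p ≡ 1 (mod 3)`** for a prime `p ∉ {2, 3}`.  (→) if `θ² = −3` then
`ω = (θ − 1)/2` satisfies `ω² + ω + 1 = 0`, so `ω` has order `3` in `𝔽_pˣ` and `3 ∣ p − 1`;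
(←) an element `ω` of order `3` (Cauchy) gives `θ = 2ω + 1`.  The guard `p ≠ 2` is load-bearing
(`−3 = 1` is a square in `𝔽₂`), as is `p ≠ 3` (`−3 = 0`). [folklore] -/
theorem isSquare_neg_three_iff {p : ℕ} (hp : p.Prime) (h2 : p ≠ 2) (h3 : p ≠ 3) :
    IsSquare (-3 : ZMod p) ↔ p % 3 = 1 := by
  haveI := Fact.mk hp
  have h2' : (2 : ZMod p) ≠ 0 := by
    intro h
    have : p ∣ 2 := (ZMod.natCast_eq_zero_iff 2 p).mp (by exact_mod_cast h)
    exact h2 ((Nat.prime_dvd_prime_iff_eq hp Nat.prime_two).mp this)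
  have h3' : (3 : ZMod p) ≠ 0 := by
    intro h
    have : p ∣ 3 := (ZMod.natCast_eq_zero_iff 3 p).mp (by exact_mod_cast h)
    exact h3 ((Nat.prime_dvd_prime_iff_eq hp Nat.prime_three).mp this)
  constructor
  · rintro ⟨θ, hθ⟩
    set ω : ZMod p := (θ - 1) / 2 with hω
    have h2ω : 2 * ω = θ - 1 := by rw [hω]; field_simp
    have hquad : ω ^ 2 + ω + 1 = 0 := by
      have h : (2 * ω) ^ 2 + 2 * (2 * ω) + 4 = 0 := by
        rw [h2ω]; linear_combination (-1 : ZMod p) * hθ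
      have h4 : (4 : ZMod p) ≠ 0 := by
        rw [show (4 : ZMod p) = 2 * 2 by norm_num]; exact mul_ne_zero h2' h2'
      have h' : (4 : ZMod p) * (ω ^ 2 + ω + 1) = 0 := by linear_combination h
      exact (mul_eq_zero.mp h').resolve_left h4
    have hω3 : ω ^ 3 = 1 := by linear_combination (ω - 1) * hquad
    have hω1 : ω ≠ 1 := by
      intro h1
      rw [h1] at hquad
      exact h3' (by linear_combination hquad)
    have hω0 : ω ≠ 0 := by
      intro h0
      rw [h0] at hquad
      exact one_ne_zero (by linear_combination hquad)
    have hord : orderOf ω = 3 := orderOf_eq_prime hω3 hω1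
    have hdvd : 3 ∣ p - 1 := hord ▸ orderOf_dvd_of_pow_eq_one (ZMod.pow_card_sub_one_eq_one hω0)
    have := hp.two_le
    omega
  · intro hp1
    have hcard : 3 ∣ Fintype.card (ZMod p)ˣ := by
      rw [ZMod.card_units p]
      have := hp.two_le
      omega
    obtain ⟨ω, hω⟩ := exists_prime_orderOf_dvd_card 3 hcard
    have hω3 : ((ω : ZMod p)) ^ 3 = 1 := by
      rw [← Units.val_pow_eq_pow_val, ← hω, pow_orderOf_eq_one, Units.val_one]
    have hω1 : (ω : ZMod p) ≠ 1 := by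
      intro h
      have : ω = 1 := Units.ext h
      rw [this, orderOf_one] at hω
      norm_num at hω
    have hquad : (ω : ZMod p) ^ 2 + ω + 1 = 0 := by
      have : ((ω : ZMod p) - 1) * ((ω : ZMod p) ^ 2 + ω + 1) = 0 := by linear_combination hω3
      exact (mul_eq_zero.mp this).resolve_left (sub_ne_zero.mpr hω1)
    exact ⟨2 * ω + 1, by linear_combination (-4 : ZMod p) * hquad⟩

/-! ### The hidden bit on the promise family is `[−3 ∈ QR_N]` -/

/-- CRT for the squareness of `−3`: for coprime `m, n`, `−3` is a square mod `mn` iff it is a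
square mod `m` and mod `n` (`ZMod.chineseRemainder`). [folklore] -/
theorem isSquare_neg_three_zmod_mul_iff {m n : ℕ} (h : m.Coprime n) :
    IsSquare (-3 : ZMod (m * n)) ↔ IsSquare (-3 : ZMod m) ∧ IsSquare (-3 : ZMod n) := by
  set e := ZMod.chineseRemainder h
  have he : e (-3) = (-3, -3) := by
    rw [map_neg, map_ofNat]; rfl
  constructor
  · intro hsq
    have h' := hsq.map e
    rw [he] at h'
    exact ⟨by simpa using h'.map (MonoidHom.fst (ZMod m) (ZMod n)),
      by simpa using h'.map (MonoidHom.snd (ZMod m) (ZMod n))⟩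
  · rintro ⟨⟨a, ha⟩, ⟨b, hb⟩⟩
    have hsq : IsSquare ((-3, -3) : ZMod m × ZMod n) := ⟨(a, b), Prod.ext ha hb⟩
    rw [← he] at hsq
    simpa using hsq.map e.symm

/-- **The hidden Eisenstein type is quadratic residuosity of `−3`.** On the promise family of the
leaf — distinct primes `p, q` with `p ≡ q ≡ 1 (mod 3)` or `(p, q) ≡ (2, 5), (5, 2) (mod 9)` — the bit
`[p ≡ 1 (mod 3)]` equals `[−3 is a square mod pq]`: in the split type `−3` is a square modulo both
primes, in the inert type it is a non-square modulo the odd factor `≡ 5 (mod 9)` (the member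
`p = 2`, `N = 2q`, is handled through `q`).  Instances: `−3 ≡ 58² (mod 91)`, `−3 ∉ QR₁₀`.
[cite: AdlemanMcCurley1994, problems C11 / O11a (quadratic residuosity modulo a composite)] -/
theorem type_iff_isSquare_neg_three {p q : ℕ} (hp : p.Prime) (hq : q.Prime) (hpq : p ≠ q)
    (ht : (p % 3 = 1 ∧ q % 3 = 1) ∨ (p % 9 = 2 ∧ q % 9 = 5) ∨ (p % 9 = 5 ∧ q % 9 = 2)) :
    p % 3 = 1 ↔ IsSquare (-3 : ZMod (p * q)) := by
  rw [isSquare_neg_three_zmod_mul_iff ((Nat.coprime_primes hp hq).mpr hpq)]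
  rcases ht with ⟨hp1, hq1⟩ | ⟨hp2, hq5⟩ | ⟨hp5, hq2⟩
  · exact ⟨fun _ => ⟨(isSquare_neg_three_iff hp (by omega) (by omega)).mpr hp1,
      (isSquare_neg_three_iff hq (by omega) (by omega)).mpr hq1⟩, fun _ => hp1⟩
  · refine ⟨fun h => by omega, fun ⟨_, h⟩ => ?_⟩
    have := (isSquare_neg_three_iff hq (by omega) (by omega)).mp h
    omega
  · refine ⟨fun h => by omega, fun ⟨h, _⟩ => ?_⟩
    have := (isSquare_neg_three_iff hp (by omega) (by omega)).mp h
    omega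

/-- **The leaf, re-typed as QR(−3)-hardness.** The registered stub `stub_phiHiding3` (left, verbatim)
is equivalent to: no PPT algorithm decides, on every Eisenstein-typed RSA modulus `N = pq` of the
promise family, whether `−3` is a quadratic residue mod `N` — the quadratic residuosity problem
modulo a composite (Adleman–McCurley 1994, C11/O11a: open) for the FIXED residue `a = −3`.  Same
algorithm both ways; `type_iff_isSquare_neg_three` identifies the two success events.
[cite: AdlemanMcCurley1994, problems C11 / O11a] -/
theorem stub_iff_qrNegThreeHard :
    (¬ ∃ D : RandAlg (List Bool) Bool, D.IsPolyTime id encodeBool ∧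
      ∀ p q : ℕ, p.Prime → q.Prime → p ≠ q → (p * q) % 9 = 1 →
        ((p % 3 = 1 ∧ q % 3 = 1) ∨ (p % 9 = 2 ∧ q % 9 = 5) ∨ (p % 9 = 5 ∧ q % 9 = 2)) →
        (2 : ℝ) / 3 ≤ D.pr id (encodeNat (p * q)) {b | b = decide (p % 3 = 1)}) ↔
    ¬ ∃ D : RandAlg (List Bool) Bool, D.IsPolyTime id encodeBool ∧
      ∀ p q : ℕ, p.Prime → q.Prime → p ≠ q → (p * q) % 9 = 1 →
        ((p % 3 = 1 ∧ q % 3 = 1) ∨ (p % 9 = 2 ∧ q % 9 = 5) ∨ (p % 9 = 5 ∧ q % 9 = 2)) →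
        (2 : ℝ) / 3 ≤ D.pr id (encodeNat (p * q)) {b | b = true ↔ IsSquare (-3 : ZMod (p * q))} := by
  refine not_congr (exists_congr fun D => and_congr_right fun _ => ?_)
  refine forall_congr' fun p => forall_congr' fun q => forall_congr' fun hp =>
    forall_congr' fun hq => forall_congr' fun hpq => forall_congr' fun _ =>
    forall_congr' fun ht => ?_
  have hset : {b : Bool | b = decide (p % 3 = 1)} =
      {b : Bool | b = true ↔ IsSquare (-3 : ZMod (p * q))} := by
    ext b
    simp only [Set.mem_setOf_eq]
    rw [← type_iff_isSquare_neg_three hp hq hpq ht]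
    cases b <;> simp
  rw [hset]

/-! ### Lossy vs. injective RSA cubing: `x ↦ x³` permutes `(ℤ/N)ˣ` iff `3 ∤ φ(N)` -/

/-- In a finite group, `x ↦ xⁿ` is a bijection iff `gcd(|G|, n) = 1`: (⇐) Mathlib's `powCoprime`;
(⇒) a common prime `ℓ` gives, by Cauchy, an element of order `ℓ` in the kernel. [folklore] -/
theorem pow_bijective_iff_coprime_card {G : Type*} [Group G] [Finite G] (n : ℕ) :
    Function.Bijective (fun x : G => x ^ n) ↔ (Nat.card G).Coprime n := by
  refine ⟨fun hbij => ?_, fun h => ?_⟩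
  · by_contra hnc
    obtain ⟨ℓ, hℓ, hℓG, hℓn⟩ := Nat.Prime.not_coprime_iff_dvd.mp hnc
    haveI := Fact.mk hℓ
    obtain ⟨g, hg⟩ := exists_prime_orderOf_dvd_card' ℓ hℓG
    have hgn : g ^ n = 1 := orderOf_dvd_iff_pow_eq_one.mp (hg ▸ hℓn)
    have h1 : g = 1 := hbij.1 (show g ^ n = (1 : G) ^ n by rw [one_pow]; exact hgn)
    rw [h1, orderOf_one] at hg
    exact hℓ.one_lt.ne hg
  · have hb := (powCoprime h).bijective
    rwa [show ⇑(powCoprime h) = fun x : G => x ^ n from funext fun _ => rfl] at hb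

/-- **RSA cubing is a permutation of `(ℤ/N)ˣ` iff `3 ∤ φ(N)`** (`N ≠ 0`): the no-instances of the
Φ-hiding(3) bit are exactly the valid RSA public keys `(N, 3)`, the yes-instances the "lossy" keys
(`x ↦ x³` is `3`- or `9`-to-`1`). [folklore] -/
theorem pow_three_bijective_iff (N : ℕ) [NeZero N] :
    Function.Bijective (fun x : (ZMod N)ˣ => x ^ 3) ↔ ¬ 3 ∣ Nat.totient N := by
  rw [pow_bijective_iff_coprime_card, Nat.card_eq_fintype_card, ZMod.card_units_eq_totient,
    Nat.coprime_comm, Nat.Prime.coprime_iff_not_dvd Nat.prime_three]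

/-! ### The quadratic character carries no bit: `(−3 | N) = +1` in both types -/

/-- The Legendre symbol `(−3 | p)` for a prime `p ∉ {2, 3}`: `+1` if `p ≡ 1 (mod 3)`, `−1`
otherwise (`isSquare_neg_three_iff`). [folklore] -/
theorem legendreSym_neg_three {p : ℕ} [Fact p.Prime] (h2 : p ≠ 2) (h3 : p ≠ 3) :
    legendreSym p (-3) = if p % 3 = 1 then 1 else -1 := by
  have hp : p.Prime := Fact.out
  have hcast : ((-3 : ℤ) : ZMod p) = -3 := by push_cast; rfl
  have hne : ((-3 : ℤ) : ZMod p) ≠ 0 := by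
    rw [hcast, neg_ne_zero]
    intro h
    have : p ∣ 3 := (ZMod.natCast_eq_zero_iff 3 p).mp (by exact_mod_cast h)
    exact h3 ((Nat.prime_dvd_prime_iff_eq hp Nat.prime_three).mp this)
  split_ifs with h1
  · rw [legendreSym.eq_one_iff p hne, hcast]
    exact (isSquare_neg_three_iff hp h2 h3).mpr h1
  · rw [legendreSym.eq_neg_one_iff p, hcast]
    exact fun hsq => h1 ((isSquare_neg_three_iff hp h2 h3).mp hsq)

/-- **No leak through the Jacobi symbol.** On the odd members of the promise family (both primes
`≠ 2`) the Jacobi symbol `(−3 | pq)` equals `+1` in BOTH types: `(+1)(+1)` in the split type,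
`(−1)(−1)` in the inert type.  So the only classical polynomial-time quadratic statistic of `N` is
constant on the family; compare Schridde–Freisleben's Jacobi-symbol break of Φ-hiding for moduli
`N = PQ^{2e}`, which this shows cannot transfer to `N = pq`.  Instances: `(−3 | 91) = (−3 | 55) = 1`.
[folklore] -/
theorem jacobiSym_neg_three_eq_one {p q : ℕ} (hp : p.Prime) (hq : q.Prime) (hp2 : p ≠ 2)
    (hq2 : q ≠ 2)
    (ht : (p % 3 = 1 ∧ q % 3 = 1) ∨ (p % 9 = 2 ∧ q % 9 = 5) ∨ (p % 9 = 5 ∧ q % 9 = 2)) :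
    jacobiSym (-3) (p * q) = 1 := by
  haveI := Fact.mk hp
  haveI := Fact.mk hq
  haveI : NeZero p := ⟨hp.ne_zero⟩
  haveI : NeZero q := ⟨hq.ne_zero⟩
  have hp3 : p ≠ 3 := by omega
  have hq3 : q ≠ 3 := by omega
  rw [jacobiSym.mul_right, ← jacobiSym.legendreSym.to_jacobiSym, ← jacobiSym.legendreSym.to_jacobiSym,
    legendreSym_neg_three hp2 hp3, legendreSym_neg_three hq2 hq3]
  rcases ht with ⟨hp1, hq1⟩ | ⟨hp9, hq9⟩ | ⟨hp9, hq9⟩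
  · rw [if_pos hp1, if_pos hq1, one_mul]
  · rw [if_neg (by omega), if_neg (by omega)]; norm_num
  · rw [if_neg (by omega), if_neg (by omega)]; norm_num

/-! ### The `3`-adic residue of `N` carries no bit -/

/-- **No `3`-adic leak.** For every `k ≥ 2` and every `c ≡ 1 (mod 9)` the residue class
`c mod 3^k` contains products `pq` of primes of BOTH types of the promise family — split
(`p ≡ q ≡ 1 (mod 3)`, `p ≠ q`) and inert (`p ≡ 2`, `q ≡ 5 (mod 9)`).  Witnesses by Dirichlet's
theorem (Mathlib `Nat.forall_exists_prime_gt_and_modEq`): `p ≡ 1, q ≡ c`, resp. `p ≡ 2`,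
`q ≡ 2⁻¹c (mod 3^k)` with `2⁻¹ = (3^k + 1)/2 ≡ 5 (mod 9)`.  So `N mod 3^k` — the natural refinement
of Cachin–Micali–Stadler's `N mod 3` leak (their Remark 1) — is constant-free of the hidden bit: a
cheap falsifier of the leaf that fails. [folklore] -/
theorem threeAdic_noLeak (k : ℕ) (hk : 2 ≤ k) (c : ℕ) (hc : c % 9 = 1) :
    (∃ p q : ℕ, p.Prime ∧ q.Prime ∧ p ≠ q ∧ p % 3 = 1 ∧ q % 3 = 1 ∧
        (p * q) % 3 ^ k = c % 3 ^ k) ∧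
    (∃ p q : ℕ, p.Prime ∧ q.Prime ∧ p % 9 = 2 ∧ q % 9 = 5 ∧ (p * q) % 3 ^ k = c % 3 ^ k) := by
  set M : ℕ := 3 ^ k with hM
  have hM0 : M ≠ 0 := pow_ne_zero k (by norm_num)
  have h9M : 9 ∣ M := by simpa using Nat.pow_dvd_pow 3 hk
  have h3M : 3 ∣ M := dvd_trans (by norm_num : 3 ∣ 9) h9M
  have hMge : 9 ≤ M := Nat.le_of_dvd (Nat.pos_of_ne_zero hM0) h9M
  have hc3 : ¬ 3 ∣ c := by omega
  have hcM : c.Coprime M :=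
    (Nat.coprime_comm.mp ((Nat.Prime.coprime_iff_not_dvd Nat.prime_three).mpr hc3)).pow_right k
  constructor
  · obtain ⟨p, -, hp, hp1⟩ := Nat.forall_exists_prime_gt_and_modEq 0 hM0 (Nat.coprime_one_left M)
    obtain ⟨q, hqp, hq, hqc⟩ := Nat.forall_exists_prime_gt_and_modEq p hM0 hcM
    have hpM : p % M = 1 := (show p % M = 1 % M from hp1).trans (Nat.mod_eq_of_lt (by omega))
    have hp3 : p % 3 = 1 := by rw [← Nat.mod_mod_of_dvd p h3M, hpM]
    have hq9 : q % 9 = c % 9 := by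
      rw [← Nat.mod_mod_of_dvd q h9M, (show q % M = c % M from hqc), Nat.mod_mod_of_dvd c h9M]
    refine ⟨p, q, hp, hq, by omega, hp3, by omega, ?_⟩
    have h := hp1.mul hqc
    rwa [one_mul] at h
  · have h2M : Nat.Coprime 2 M := Nat.Coprime.pow_right k (by norm_num)
    obtain ⟨p, -, hp, hp2⟩ := Nat.forall_exists_prime_gt_and_modEq 0 hM0 h2M
    have hMo : M % 2 = 1 := Nat.odd_iff.mp (Odd.pow (Nat.odd_iff.mpr (by norm_num)))
    set m : ℕ := (M + 1) / 2 with hm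
    have hm2 : 2 * m = M + 1 := by omega
    have hm9 : m % 9 = 5 := by omega
    have hm3 : ¬ 3 ∣ m := by omega
    have hd3 : ¬ 3 ∣ m * c := fun h => ((Nat.Prime.dvd_mul Nat.prime_three).mp h).elim hm3 hc3
    have hdM : (m * c).Coprime M :=
      (Nat.coprime_comm.mp ((Nat.Prime.coprime_iff_not_dvd Nat.prime_three).mpr hd3)).pow_right k
    obtain ⟨q, -, hq, hqd⟩ := Nat.forall_exists_prime_gt_and_modEq 0 hM0 hdM
    have hpM : p % M = 2 := (show p % M = 2 % M from hp2).trans (Nat.mod_eq_of_lt (by omega))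
    have hp9 : p % 9 = 2 := by rw [← Nat.mod_mod_of_dvd p h9M, hpM]
    have hd9 : (m * c) % 9 = 5 := by rw [Nat.mul_mod, hm9, hc]
    have hq9 : q % 9 = 5 := by
      rw [← Nat.mod_mod_of_dvd q h9M, (show q % M = (m * c) % M from hqd), Nat.mod_mod_of_dvd _ h9M,
        hd9]
    refine ⟨p, q, hp, hq, hp9, hq9, ?_⟩
    refine (hp2.mul hqd).trans ?_
    show (2 * (m * c)) % M = c % M
    rw [← mul_assoc, hm2, add_mul, one_mul, add_comm, Nat.add_mul_mod_self_left]

end Summit.QuantumAdvantage.QuantumAdvantage.Theorems
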